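import Summits.QuantumFields.YangMills.Theorems.UnitScaleTiltProp7FibreLevelMassPerLevelT3
import HarnessLib

/-!
# Route `UnitScaleTilt`, crux K1 «MinimiserStabilityRegPr» (stmt-QuantumFields-19200), route-R E′ (A′) P-A2 (β), row «(n3)₂-sym» (= H2-1ˢ, px21 g7's N-line), brick N6d —
# THE DEVIATION OF THE LEVEL RATIOS FROM THE SOURCELESS REDUCED FAMILY, IN (n3)'s NUMERALS:
# `Σ_b‖Y_i(b) − G_i(b)‖² ≤ (72·B² + 2·10⁶·L⁴θ²ℓ⁻²·Σ‖Y‖²)·Lⁱ` for every `i ≤ K − n` (`B² = 200L⁴(CURL + DIV) + 4·10⁹L⁹εℓ⁻²Σ‖Y‖²`; d = 3, `SU(2)`)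

Cell `ym3-torus` (HUMAN RULING D-0037, YM ladder rung R3), D-0154 (3c) twin-width seat `ym-routeR-w3` (gen 8); px21 g7 NAMER WORD №4 (N-line) OPEN OFFER «N6d», SPEC of record
(2026-08-29 09:04Z).  Sequel of this lineage's ✓ `Prop7FibreLevelMass` ∕ ✓ `Prop7FibreLevelMassT3` (routeR-w3 g2) and of ✓ `Prop7FibreLevelMassPerLevelT3` (routeR-w6 g3), whose
§2 proof is re-run here line for line.  THEOREMS ONLY (0 `def`, 0 `sorry`); `--supports stmt-QuantumFields-19200 --as helper`, count-neutral.  YM₃ on T³ is a ladder rung (R3) —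
NOT d = 4, NOT infinite volume, NOT a mass gap, NOT the Clay problem; nothing here claims `hN2s`, (β), E′, the stub `stub_existenceMinimalOrbit`, the crux or the gap.

WHY.  px21 g7's N6b (the member knit of the «(n3)₂-sym» supplier) localises the FIRST-order level ratios `Y_i := pertVar Ū₀^{(i)} W̄^{(i)}` through the sourceless reduced
family `G1_i` of the structure theorem (N3's local `ℓ²` Jensen reads `G1` only); the difference `Y_i − G1_i = (Y_i − Q^{(i)}Y) + P_{Ū₀^{(i)}}Λ_i` (✓ `trueLinIter_structure`) is
charged GLOBALLY: the nonlinear defect `Y_i − Q^{(i)}Y` by (n3)'s scalar induction run UP TO LEVEL `i` with the depth-`i` coefficient `θ_i := θ·ρ^{2((K−n)−i)}` (the two-block sups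
are `ℓ`-small relative to the TOP, so the defect inherits `θ²ℓ⁻²·Lⁱ` — the B₂′ slot of `hN2s`, no A-slot content), and the coarse gauge function by (R-B) at every level.

WHAT IS PROVED (ns `…Theorems.Prop7LevelRatioSubReducedT3`).
* §1 ★ `sum_normSq_levelRatio_sub_reduced_le` (any `P`, `SU(N)`, `k ≤ m + K`): `Σ_c‖Y_k c − G k c‖² ≤ 2·Σ_c‖Y_k c − Q k (pertVar U₀ W) c‖² + 8·d·Σ_y‖Λ k y‖²`.
* §2 ★★ `sum_normSq_levelRatio_sub_trueLinIter_le_T3` (d = 3, `SU(2)`; binders of ✓ `sum_normSq_levelRatio_le_explicit_T3` VERBATIM): for every `i ≤ K − n`,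
  `Σ_c‖Y_i c − Q i (pertVar U₀ W) c‖² ≤ (24·B² + 10⁶·L⁴θ²ℓ⁻²Σ‖Y‖²)·Lⁱ`.
* §3 ★★ `sum_normSq_levelRatio_sub_reduced_le_T3` — the title: `Σ_b‖Y_i b − G i b‖² ≤ (72·B² + 2·10⁶·L⁴θ²ℓ⁻²Σ‖Y‖²)·Lⁱ` (§1 + §2 + ✓ `sum_normSq_covIterLambda_le_level`).
HONEST SCOPE.  A knit of landed theorems plus numerals (constants generous, k- and volume-independent); displayed as in the parent files: the plaquette bound of `U₀`, the recursion
families (zero content), the per-level two-block sups `μ_j` with their (B6)-shape bound and `θ`.  No fibre hypothesis.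

References: T. Bałaban, CMP 98 (1985) 17–51 [Balaban1985Averaging] (Prop. 3 (122)–(126) p.36); CMP 95 (1984) 17–40 [Balaban1984PropagatorsI] ((1.18)–(1.20) pp.19–20);
CMP 99 (1985) 389–434 [Balaban1985BackgroundPropagators] (Thm 3.11 p.416); CMP 102 (1985) 277–309 [Balaban1985Variational] ((14)–(15) p.280, Prop. 7 p.299).
-/

set_option autoImplicit false

noncomputable section

open scoped BigOperators Matrix.Norms.L2Operator Matrix

namespace Summit.QuantumFields.YangMills.Theorems.Prop7LevelRatioSubReducedT3

open Literature.MathematicalPhysics.QuantumFieldTheory.Balaban1983to89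
open Literature.MathematicalPhysics.QuantumFieldTheory.Balaban1983to89.T3ContinuumYM3Torus
open Finset T4Continuum T4ReflectionCone BlockAveraging AveragingRT ExpMeanLog BlockAveragingEMLLinearised BlockAveragingEMLLinearisedBackground
  BlockAveragingEMLProp2 B1RG242Torus
open B9Eq39Adjoint (curl divB)
open B10Eq27TorusAxialLog (holT unitsField toUField)
open B9TorusCalculus (torusT)
open Summit.QuantumFields.YangMills.Theorems.Prop7CurvedLandauKnitT3 (smallness_T3 three_le_L)
open Summit.QuantumFields.YangMills.Theorems.Prop7CurvedLandauRowE (loop_size_geom size_numerals)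
open Summit.QuantumFields.YangMills.Theorems.Prop7CovIterLambdaBound (tower_plaq_lt plaqSmall_of_le_of_lt)
open Summit.QuantumFields.YangMills.Theorems.Prop7FibreLevelMass (sqrt_sum_normSq_levelRatio_le sqrt_sum_normSq_levelRatio_sub_trueLinIter_le_mass)
open Summit.QuantumFields.YangMills.Theorems.Prop7FibreLevelMassInduction (levelMass_induction)
open Summit.QuantumFields.YangMills.Theorems.Prop7FibreLevelMassT3Letters (rho_facts two_sqrt_d_facts K0_nonneg K0_le theta_smallness coeff_of_B6
  level_exp_le rho_pow_mul_sqrt_le sq_le_of_rho_pow_mul_le endgame sum_normSq_covIterLambda_le_level)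
open Summit.QuantumFields.YangMills.Theorems.Prop7TrueLinIterStructure (trueLinIter_structure norm_pureGauge_le)
open Summit.QuantumFields.YangMills.Theorems.Prop7PinnedFlatCoercivity (sum_pbond_tgt_add_src)

/-! ## §1 ★ The level ratios minus the reduced family, through the structure identity -/

section Generic

variable {P : Params} {N : ℕ} [NeZero N]

/-- ★ **THE LEVEL RATIOS MINUS THE SOURCELESS REDUCED FAMILY** (any `P`, `SU(N)`, `k ≤ m + K`): for the recursion families of record (`G 0 = pertVar U₀ W`,
`G (j+1) = T_jG_j − P(CM_jG_j)`, `Λ 0 = 0`, `Λ (j+1) z = CM_j(G_j)(z) + Λ_j(emb z)`) along the tower `Ū₀^{(j)}` whose loop variables are within `a_j < δ_N` of `1`,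
`Σ_c‖Y_k c − G k c‖² ≤ 2·Σ_c‖Y_k c − Q k (pertVar U₀ W) c‖² + 8·d·Σ_y‖Λ k y‖²` (`Y_k := pertVar Ū₀^{(k)} W̄^{(k)}`; ✓ `trueLinIter_structure`: `Q k Y = G_k + P_{Ū₀^{(k)}}Λ_k`,
✓ `norm_pureGauge_le`, `‖a + b‖² ≤ 2‖a‖² + 2‖b‖²`, every site is the source of `d` and the target of `d` bonds). [cite: Balaban1985Averaging, Prop. 3 (122)-(126) p.36; Balaban1984PropagatorsI, (1.18)-(1.20) pp.19-20] -/
theorem sum_normSq_levelRatio_sub_reduced_le (U₀ W : GaugeField P 0 (Matrix.specialUnitaryGroup (Fin N) ℂ)) (k : ℕ)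
    (Q : (k : ℕ) → (PBond P 0 → Matrix (Fin N) (Fin N) ℂ) → PBond P k → Matrix (Fin N) (Fin N) ℂ) (hQ0 : ∀ Y, Q 0 Y = Y)
    (hQs : ∀ (k : ℕ) (Y : PBond P 0 → Matrix (Fin N) (Fin N) ℂ) (c : PBond P (k + 1)), Q (k + 1) Y c
      = (fderiv ℂ (eml : (Idx P → Matrix (Fin N) (Fin N) ℂ) → Matrix (Fin N) (Fin N) ℂ)
            (fun i => ((loopHol (Averaging.iter (fun i => blockAvg (P := P) (j := i) (expMeanLogSU (n := Fin N))) k U₀) c i : Matrix.specialUnitaryGroup (Fin N) ℂ) : Matrix (Fin N) (Fin N) ℂ))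
            (fun i => covWalkSum (Averaging.iter (fun i => blockAvg (P := P) (j := i) (expMeanLogSU (n := Fin N))) k U₀) (Q k Y) (walk (emb c.src) (loopWord P.L c.dir (off i.1) i.2.1 i.2.2))
              * ((loopHol (Averaging.iter (fun i => blockAvg (P := P) (j := i) (expMeanLogSU (n := Fin N))) k U₀) c i : Matrix.specialUnitaryGroup (Fin N) ℂ) : Matrix (Fin N) (Fin N) ℂ))
            * star ((corr (expMeanLogSU (n := Fin N)) (Averaging.iter (fun i => blockAvg (P := P) (j := i) (expMeanLogSU (n := Fin N))) k U₀) c : Matrix.specialUnitaryGroup (Fin N) ℂ) : Matrix (Fin N) (Fin N) ℂ)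
          + ((corr (expMeanLogSU (n := Fin N)) (Averaging.iter (fun i => blockAvg (P := P) (j := i) (expMeanLogSU (n := Fin N))) k U₀) c : Matrix.specialUnitaryGroup (Fin N) ℂ) : Matrix (Fin N) (Fin N) ℂ)
            * covWalkSum (Averaging.iter (fun i => blockAvg (P := P) (j := i) (expMeanLogSU (n := Fin N))) k U₀) (Q k Y) (walk (emb c.src) (List.replicate P.L (c.dir, true)))
            * star ((corr (expMeanLogSU (n := Fin N)) (Averaging.iter (fun i => blockAvg (P := P) (j := i) (expMeanLogSU (n := Fin N))) k U₀) c : Matrix.specialUnitaryGroup (Fin N) ℂ) : Matrix (Fin N) (Fin N) ℂ)))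
    (G : (k : ℕ) → PBond P k → Matrix (Fin N) (Fin N) ℂ) (Λ : (k : ℕ) → Site P k → Matrix (Fin N) (Fin N) ℂ)
    (hG0 : ∀ b, G 0 b = pertVar U₀ W b) (hΛ0 : ∀ x, Λ 0 x = 0)
    (hΛs : ∀ (k : ℕ) (z : Site P (k + 1)), Λ (k + 1) z
      = (((Fintype.card (Idx P) : ℂ))⁻¹ • ∑ i : Idx P,
              covWalkSum (Averaging.iter (fun i => blockAvg (P := P) (j := i) (expMeanLogSU (n := Fin N))) k U₀) (G k) (walk (emb z) (stairWord i.2.1 (off i.1))))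
        + Λ k (emb z))
    (hGs : ∀ (k : ℕ) (c : PBond P (k + 1)), G (k + 1) c
      = (fderiv ℂ (eml : (Idx P → Matrix (Fin N) (Fin N) ℂ) → Matrix (Fin N) (Fin N) ℂ)
            (fun i => ((loopHol (Averaging.iter (fun i => blockAvg (P := P) (j := i) (expMeanLogSU (n := Fin N))) k U₀) c i : Matrix.specialUnitaryGroup (Fin N) ℂ) : Matrix (Fin N) (Fin N) ℂ))
            (fun i => covWalkSum (Averaging.iter (fun i => blockAvg (P := P) (j := i) (expMeanLogSU (n := Fin N))) k U₀) (G k) (walk (emb c.src) (loopWord P.L c.dir (off i.1) i.2.1 i.2.2))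
              * ((loopHol (Averaging.iter (fun i => blockAvg (P := P) (j := i) (expMeanLogSU (n := Fin N))) k U₀) c i : Matrix.specialUnitaryGroup (Fin N) ℂ) : Matrix (Fin N) (Fin N) ℂ))
            * star ((corr (expMeanLogSU (n := Fin N)) (Averaging.iter (fun i => blockAvg (P := P) (j := i) (expMeanLogSU (n := Fin N))) k U₀) c : Matrix.specialUnitaryGroup (Fin N) ℂ) : Matrix (Fin N) (Fin N) ℂ)
          + ((corr (expMeanLogSU (n := Fin N)) (Averaging.iter (fun i => blockAvg (P := P) (j := i) (expMeanLogSU (n := Fin N))) k U₀) c : Matrix.specialUnitaryGroup (Fin N) ℂ) : Matrix (Fin N) (Fin N) ℂ)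
            * covWalkSum (Averaging.iter (fun i => blockAvg (P := P) (j := i) (expMeanLogSU (n := Fin N))) k U₀) (G k) (walk (emb c.src) (List.replicate P.L (c.dir, true)))
            * star ((corr (expMeanLogSU (n := Fin N)) (Averaging.iter (fun i => blockAvg (P := P) (j := i) (expMeanLogSU (n := Fin N))) k U₀) c : Matrix.specialUnitaryGroup (Fin N) ℂ) : Matrix (Fin N) (Fin N) ℂ))
        - ((((Fintype.card (Idx P) : ℂ))⁻¹ • ∑ i : Idx P,
              covWalkSum (Averaging.iter (fun i => blockAvg (P := P) (j := i) (expMeanLogSU (n := Fin N))) k U₀) (G k) (walk (emb c.src) (stairWord i.2.1 (off i.1))))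
            - ((Averaging.iter (fun i => blockAvg (P := P) (j := i) (expMeanLogSU (n := Fin N))) (k + 1) U₀ c : Matrix.specialUnitaryGroup (Fin N) ℂ) : Matrix (Fin N) (Fin N) ℂ)
              * (((Fintype.card (Idx P) : ℂ))⁻¹ • ∑ i : Idx P,
              covWalkSum (Averaging.iter (fun i => blockAvg (P := P) (j := i) (expMeanLogSU (n := Fin N))) k U₀) (G k) (walk (emb c.tgt) (stairWord i.2.1 (off i.1))))
              * star ((Averaging.iter (fun i => blockAvg (P := P) (j := i) (expMeanLogSU (n := Fin N))) (k + 1) U₀ c : Matrix.specialUnitaryGroup (Fin N) ℂ) : Matrix (Fin N) (Fin N) ℂ)))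
    (a : ℕ → ℝ)
    (hα : ∀ j < k, ∀ (c : PBond P (j + 1)) (i : Idx P), dist1 (loopHol (Averaging.iter (fun i => blockAvg (P := P) (j := i) (expMeanLogSU (n := Fin N))) j U₀) c i) ≤ a j)
    (haN : ∀ j < k, a j < deltaSU (Fin N)) :
    ∑ c : PBond P k, ‖(pertVar (Averaging.iter (fun i => blockAvg (P := P) (j := i) (expMeanLogSU (n := Fin N))) k U₀) (Averaging.iter (fun i => blockAvg (P := P) (j := i) (expMeanLogSU (n := Fin N))) k W)) c - G k c‖ ^ 2
      ≤ 2 * ∑ c : PBond P k, ‖(pertVar (Averaging.iter (fun i => blockAvg (P := P) (j := i) (expMeanLogSU (n := Fin N))) k U₀) (Averaging.iter (fun i => blockAvg (P := P) (j := i) (expMeanLogSU (n := Fin N))) k W)) c - Q k (pertVar U₀ W) c‖ ^ 2 + 8 * P.d * ∑ y : Site P k, ‖Λ k y‖ ^ 2 := by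
  -- the (0.4) guards from the loop sizes
  have hg : ∀ j < k, ∀ (c : PBond P (j + 1)) (i : Idx P),
      dist1 (loopHol (Averaging.iter (fun i => blockAvg (P := P) (j := i) (expMeanLogSU (n := Fin N))) j U₀) c i) < deltaSU (Fin N) :=
    fun j hj c i => (hα j hj c i).trans_lt (haN j hj)
  -- the structure identity, pointwise
  have hpt : ∀ c : PBond P k, ‖(pertVar (Averaging.iter (fun i => blockAvg (P := P) (j := i) (expMeanLogSU (n := Fin N))) k U₀) (Averaging.iter (fun i => blockAvg (P := P) (j := i) (expMeanLogSU (n := Fin N))) k W)) c - G k c‖ ^ 2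
      ≤ 2 * ‖(pertVar (Averaging.iter (fun i => blockAvg (P := P) (j := i) (expMeanLogSU (n := Fin N))) k U₀) (Averaging.iter (fun i => blockAvg (P := P) (j := i) (expMeanLogSU (n := Fin N))) k W)) c - Q k (pertVar U₀ W) c‖ ^ 2 + 4 * (‖Λ k c.tgt‖ ^ 2 + ‖Λ k c.src‖ ^ 2) := fun c => by
    have h := trueLinIter_structure U₀ Q hQ0 hQs (pertVar U₀ W)
      (fun k Gk z => ((Fintype.card (Idx P) : ℂ))⁻¹ • ∑ i : Idx P,
        covWalkSum (Averaging.iter (fun i => blockAvg (P := P) (j := i) (expMeanLogSU (n := Fin N))) k U₀) Gk (walk (emb z) (stairWord i.2.1 (off i.1))))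
      G Λ hG0 hΛ0 hΛs hGs k hg c
    have hP := norm_pureGauge_le (Averaging.iter (fun i => blockAvg (P := P) (j := i) (expMeanLogSU (n := Fin N))) k U₀) (Λ k) c
    have hdec : (pertVar (Averaging.iter (fun i => blockAvg (P := P) (j := i) (expMeanLogSU (n := Fin N))) k U₀) (Averaging.iter (fun i => blockAvg (P := P) (j := i) (expMeanLogSU (n := Fin N))) k W)) c - G k c
        = ((pertVar (Averaging.iter (fun i => blockAvg (P := P) (j := i) (expMeanLogSU (n := Fin N))) k U₀) (Averaging.iter (fun i => blockAvg (P := P) (j := i) (expMeanLogSU (n := Fin N))) k W)) c - Q k (pertVar U₀ W) c) + (Q k (pertVar U₀ W) c - G k c) := by abel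
    have hX : ‖Q k (pertVar U₀ W) c - G k c‖ ≤ ‖Λ k c.src‖ + ‖Λ k c.tgt‖ := by
      rw [h, add_sub_cancel_left]; exact hP
    have h1 : ‖(pertVar (Averaging.iter (fun i => blockAvg (P := P) (j := i) (expMeanLogSU (n := Fin N))) k U₀) (Averaging.iter (fun i => blockAvg (P := P) (j := i) (expMeanLogSU (n := Fin N))) k W)) c - G k c‖ ≤ ‖(pertVar (Averaging.iter (fun i => blockAvg (P := P) (j := i) (expMeanLogSU (n := Fin N))) k U₀) (Averaging.iter (fun i => blockAvg (P := P) (j := i) (expMeanLogSU (n := Fin N))) k W)) c - Q k (pertVar U₀ W) c‖ + (‖Λ k c.src‖ + ‖Λ k c.tgt‖) := by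
      rw [hdec]; exact (norm_add_le _ _).trans (add_le_add le_rfl hX)
    have h0 : 0 ≤ ‖(pertVar (Averaging.iter (fun i => blockAvg (P := P) (j := i) (expMeanLogSU (n := Fin N))) k U₀) (Averaging.iter (fun i => blockAvg (P := P) (j := i) (expMeanLogSU (n := Fin N))) k W)) c - G k c‖ := norm_nonneg _
    have h2 := pow_le_pow_left₀ h0 h1 2
    nlinarith [h2, sq_nonneg (‖(pertVar (Averaging.iter (fun i => blockAvg (P := P) (j := i) (expMeanLogSU (n := Fin N))) k U₀) (Averaging.iter (fun i => blockAvg (P := P) (j := i) (expMeanLogSU (n := Fin N))) k W)) c - Q k (pertVar U₀ W) c‖ - (‖Λ k c.src‖ + ‖Λ k c.tgt‖)), sq_nonneg (‖Λ k c.src‖ - ‖Λ k c.tgt‖),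
      norm_nonneg (Λ k c.src), norm_nonneg (Λ k c.tgt)]
  calc ∑ c : PBond P k, ‖(pertVar (Averaging.iter (fun i => blockAvg (P := P) (j := i) (expMeanLogSU (n := Fin N))) k U₀) (Averaging.iter (fun i => blockAvg (P := P) (j := i) (expMeanLogSU (n := Fin N))) k W)) c - G k c‖ ^ 2
      ≤ ∑ c : PBond P k, (2 * ‖(pertVar (Averaging.iter (fun i => blockAvg (P := P) (j := i) (expMeanLogSU (n := Fin N))) k U₀) (Averaging.iter (fun i => blockAvg (P := P) (j := i) (expMeanLogSU (n := Fin N))) k W)) c - Q k (pertVar U₀ W) c‖ ^ 2 + 4 * (‖Λ k c.tgt‖ ^ 2 + ‖Λ k c.src‖ ^ 2)) := Finset.sum_le_sum fun c _ => hpt c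
    _ = 2 * ∑ c : PBond P k, ‖(pertVar (Averaging.iter (fun i => blockAvg (P := P) (j := i) (expMeanLogSU (n := Fin N))) k U₀) (Averaging.iter (fun i => blockAvg (P := P) (j := i) (expMeanLogSU (n := Fin N))) k W)) c - Q k (pertVar U₀ W) c‖ ^ 2 + 4 * ∑ c : PBond P k, (‖Λ k c.tgt‖ ^ 2 + ‖Λ k c.src‖ ^ 2) := by
        rw [Finset.sum_add_distrib, Finset.mul_sum, Finset.mul_sum]
    _ = 2 * ∑ c : PBond P k, ‖(pertVar (Averaging.iter (fun i => blockAvg (P := P) (j := i) (expMeanLogSU (n := Fin N))) k U₀) (Averaging.iter (fun i => blockAvg (P := P) (j := i) (expMeanLogSU (n := Fin N))) k W)) c - Q k (pertVar U₀ W) c‖ ^ 2 + 8 * P.d * ∑ y : Site P k, ‖Λ k y‖ ^ 2 := by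
        rw [sum_pbond_tgt_add_src (fun y => ‖Λ k y‖ ^ 2)]; ring

end Generic

/-! ## §2 ★★ The nonlinear defect of the level ratios at every level, in (n3)'s numerals -/

/-- ★★ **THE LEVEL RATIOS MINUS THE TRUE-LINEARISED ITERATE, IN `ℓ²`, AT EVERY LEVEL `i ≤ K − n`, EXPLICIT (d = 3, `SU(2)`).**  Binders of
✓ `Prop7FibreLevelMassPerLevelT3.sum_normSq_levelRatio_le_explicit_T3` VERBATIM (`U₀, W`; `dist1(U₀(∂p)) ≤ εℓ⁻²`, `10⁶L⁵ε ≤ 1`; the recursion families `Q G S Λ` of record at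
`Y := pertVar U₀ W`; per-level two-block sups `μ_j` with `72μ_j ≤ 1`, `3μ_j + 1∕24 < δ₂`, the (B6)-shape `7800L³ℓμ_j ≤ θLʲ`, `1000θL ≤ 1`; NO fibre hypothesis).  THEN for every `i ≤ K − n`,
`Σ_c‖Y_i c − Q i (pertVar U₀ W) c‖² ≤ (24·(200L⁴(CURL + DIV) + 4·10⁹L⁹εℓ⁻²Σ‖Y‖²) + 10⁶·L⁴·θ²·ℓ⁻²·Σ‖Y‖²)·Lⁱ` — the SECOND conjunct of ✓ `levelMass_induction` run up to
level `i` with `θ_i := θ·ρ^{2((K−n)−i)}` (`260μ_lC₁ ≤ θ_i·ρ^{2(i−l)}` by ✓ `coeff_of_B6`), ✓ `sqrt_sum_normSq_levelRatio_sub_trueLinIter_le_mass`, ✓ `endgame`, and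
`θ_i²·(Lⁱ)⁻¹ = θ²ℓ⁻²Lⁱ`. [cite: Balaban1985Averaging, Prop. 3 (122)-(126) p.36; Balaban1984PropagatorsI, (1.18)-(1.20) pp.19-20; Balaban1985BackgroundPropagators, Thm 3.11 p.416; Balaban1985Variational, (14)-(15) p.280, Prop. 7 p.299] -/
theorem sum_normSq_levelRatio_sub_trueLinIter_le_T3 (F : T3Family) (n K : ℕ)
    (U₀ W : GaugeField (F.P K) 0 (Matrix.specialUnitaryGroup (Fin 2) ℂ)) {ε : ℝ} (hε : 0 < ε) (hεL : 1000000 * (F.L : ℝ) ^ 5 * ε ≤ 1)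
    (hU : ∀ p : Plaq (F.P K) 0, dist1 (GaugeField.plaqHol U₀ p) ≤ ε * (((F.L : ℝ) ^ (K - n)) ^ 2)⁻¹)
    (Q : (k : ℕ) → (PBond (F.P K) 0 → Matrix (Fin 2) (Fin 2) ℂ) → PBond (F.P K) k → Matrix (Fin 2) (Fin 2) ℂ) (hQ0 : ∀ Y, Q 0 Y = Y)
    (hQs : ∀ (k : ℕ) (Y : PBond (F.P K) 0 → Matrix (Fin 2) (Fin 2) ℂ) (c : PBond (F.P K) (k + 1)), Q (k + 1) Y c
      = (fderiv ℂ (eml : (Idx (F.P K) → Matrix (Fin 2) (Fin 2) ℂ) → Matrix (Fin 2) (Fin 2) ℂ)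
            (fun i => ((loopHol (Averaging.iter (fun i => blockAvg (P := (F.P K)) (j := i) (expMeanLogSU (n := Fin 2))) k U₀) c i : Matrix.specialUnitaryGroup (Fin 2) ℂ) : Matrix (Fin 2) (Fin 2) ℂ))
            (fun i => covWalkSum (Averaging.iter (fun i => blockAvg (P := (F.P K)) (j := i) (expMeanLogSU (n := Fin 2))) k U₀) (Q k Y) (walk (emb c.src) (loopWord (F.P K).L c.dir (off i.1) i.2.1 i.2.2))
              * ((loopHol (Averaging.iter (fun i => blockAvg (P := (F.P K)) (j := i) (expMeanLogSU (n := Fin 2))) k U₀) c i : Matrix.specialUnitaryGroup (Fin 2) ℂ) : Matrix (Fin 2) (Fin 2) ℂ))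
            * star ((corr (expMeanLogSU (n := Fin 2)) (Averaging.iter (fun i => blockAvg (P := (F.P K)) (j := i) (expMeanLogSU (n := Fin 2))) k U₀) c : Matrix.specialUnitaryGroup (Fin 2) ℂ) : Matrix (Fin 2) (Fin 2) ℂ)
          + ((corr (expMeanLogSU (n := Fin 2)) (Averaging.iter (fun i => blockAvg (P := (F.P K)) (j := i) (expMeanLogSU (n := Fin 2))) k U₀) c : Matrix.specialUnitaryGroup (Fin 2) ℂ) : Matrix (Fin 2) (Fin 2) ℂ)
            * covWalkSum (Averaging.iter (fun i => blockAvg (P := (F.P K)) (j := i) (expMeanLogSU (n := Fin 2))) k U₀) (Q k Y) (walk (emb c.src) (List.replicate (F.P K).L (c.dir, true)))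
            * star ((corr (expMeanLogSU (n := Fin 2)) (Averaging.iter (fun i => blockAvg (P := (F.P K)) (j := i) (expMeanLogSU (n := Fin 2))) k U₀) c : Matrix.specialUnitaryGroup (Fin 2) ℂ) : Matrix (Fin 2) (Fin 2) ℂ)))
    (G S : (k : ℕ) → PBond (F.P K) k → Matrix (Fin 2) (Fin 2) ℂ) (Λ : (k : ℕ) → Site (F.P K) k → Matrix (Fin 2) (Fin 2) ℂ)
    (hG0 : ∀ b, G 0 b = pertVar U₀ W b) (hS0 : ∀ b, S 0 b = pertVar U₀ W b) (hΛ0 : ∀ x, Λ 0 x = 0)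
    (hΛs : ∀ (k : ℕ) (z : Site (F.P K) (k + 1)), Λ (k + 1) z
      = (((Fintype.card (Idx (F.P K)) : ℂ))⁻¹ • ∑ i : Idx (F.P K),
              covWalkSum (Averaging.iter (fun i => blockAvg (P := (F.P K)) (j := i) (expMeanLogSU (n := Fin 2))) k U₀) (G k) (walk (emb z) (stairWord i.2.1 (off i.1))))
        + Λ k (emb z))
    (hGs : ∀ (k : ℕ) (c : PBond (F.P K) (k + 1)), G (k + 1) c
      = (fderiv ℂ (eml : (Idx (F.P K) → Matrix (Fin 2) (Fin 2) ℂ) → Matrix (Fin 2) (Fin 2) ℂ)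
            (fun i => ((loopHol (Averaging.iter (fun i => blockAvg (P := (F.P K)) (j := i) (expMeanLogSU (n := Fin 2))) k U₀) c i : Matrix.specialUnitaryGroup (Fin 2) ℂ) : Matrix (Fin 2) (Fin 2) ℂ))
            (fun i => covWalkSum (Averaging.iter (fun i => blockAvg (P := (F.P K)) (j := i) (expMeanLogSU (n := Fin 2))) k U₀) (G k) (walk (emb c.src) (loopWord (F.P K).L c.dir (off i.1) i.2.1 i.2.2))
              * ((loopHol (Averaging.iter (fun i => blockAvg (P := (F.P K)) (j := i) (expMeanLogSU (n := Fin 2))) k U₀) c i : Matrix.specialUnitaryGroup (Fin 2) ℂ) : Matrix (Fin 2) (Fin 2) ℂ))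
            * star ((corr (expMeanLogSU (n := Fin 2)) (Averaging.iter (fun i => blockAvg (P := (F.P K)) (j := i) (expMeanLogSU (n := Fin 2))) k U₀) c : Matrix.specialUnitaryGroup (Fin 2) ℂ) : Matrix (Fin 2) (Fin 2) ℂ)
          + ((corr (expMeanLogSU (n := Fin 2)) (Averaging.iter (fun i => blockAvg (P := (F.P K)) (j := i) (expMeanLogSU (n := Fin 2))) k U₀) c : Matrix.specialUnitaryGroup (Fin 2) ℂ) : Matrix (Fin 2) (Fin 2) ℂ)
            * covWalkSum (Averaging.iter (fun i => blockAvg (P := (F.P K)) (j := i) (expMeanLogSU (n := Fin 2))) k U₀) (G k) (walk (emb c.src) (List.replicate (F.P K).L (c.dir, true)))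
            * star ((corr (expMeanLogSU (n := Fin 2)) (Averaging.iter (fun i => blockAvg (P := (F.P K)) (j := i) (expMeanLogSU (n := Fin 2))) k U₀) c : Matrix.specialUnitaryGroup (Fin 2) ℂ) : Matrix (Fin 2) (Fin 2) ℂ))
        - ((((Fintype.card (Idx (F.P K)) : ℂ))⁻¹ • ∑ i : Idx (F.P K),
              covWalkSum (Averaging.iter (fun i => blockAvg (P := (F.P K)) (j := i) (expMeanLogSU (n := Fin 2))) k U₀) (G k) (walk (emb c.src) (stairWord i.2.1 (off i.1))))
            - ((Averaging.iter (fun i => blockAvg (P := (F.P K)) (j := i) (expMeanLogSU (n := Fin 2))) (k + 1) U₀ c : Matrix.specialUnitaryGroup (Fin 2) ℂ) : Matrix (Fin 2) (Fin 2) ℂ)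
              * (((Fintype.card (Idx (F.P K)) : ℂ))⁻¹ • ∑ i : Idx (F.P K),
              covWalkSum (Averaging.iter (fun i => blockAvg (P := (F.P K)) (j := i) (expMeanLogSU (n := Fin 2))) k U₀) (G k) (walk (emb c.tgt) (stairWord i.2.1 (off i.1))))
              * star ((Averaging.iter (fun i => blockAvg (P := (F.P K)) (j := i) (expMeanLogSU (n := Fin 2))) (k + 1) U₀ c : Matrix.specialUnitaryGroup (Fin 2) ℂ) : Matrix (Fin 2) (Fin 2) ℂ)))
    (hSs : ∀ (k : ℕ) (c : PBond (F.P K) (k + 1)), S (k + 1) c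
      = ((Fintype.card (Idx (F.P K)) : ℂ))⁻¹ • ∑ i : Idx (F.P K),
          ((holAt (Averaging.iter (fun i => blockAvg (P := (F.P K)) (j := i) (expMeanLogSU (n := Fin 2))) k U₀) (walk (emb c.src) (stairWord i.2.1 (off i.1))) : Matrix.specialUnitaryGroup (Fin 2) ℂ) : Matrix (Fin 2) (Fin 2) ℂ) *
            covWalkSum (Averaging.iter (fun i => blockAvg (P := (F.P K)) (j := i) (expMeanLogSU (n := Fin 2))) k U₀) (S k)
              (walk (walkEnd (emb c.src) (stairWord i.2.1 (off i.1))) (List.replicate (F.P K).L (c.dir, true))) *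
          star ((holAt (Averaging.iter (fun i => blockAvg (P := (F.P K)) (j := i) (expMeanLogSU (n := Fin 2))) k U₀) (walk (emb c.src) (stairWord i.2.1 (off i.1))) : Matrix.specialUnitaryGroup (Fin 2) ℂ) : Matrix (Fin 2) (Fin 2) ℂ))
    (μ : ℕ → ℝ) (hμ0 : ∀ j < K - n, 0 ≤ μ j)
    (hμ : ∀ j < K - n, ∀ c : PBond (F.P K) (j + 1), ((((F.P K).d + 2) * (F.P K).L : ℕ) : ℝ) * ∑ b ∈ (univ.filter (fun b : PBond (F.P K) j => blockOf b.src = c.src ∨ blockOf b.src = c.tgt)), ‖(pertVar (Averaging.iter (fun i => blockAvg (P := (F.P K)) (j := i) (expMeanLogSU (n := Fin 2))) j U₀) (Averaging.iter (fun i => blockAvg (P := (F.P K)) (j := i) (expMeanLogSU (n := Fin 2))) j W)) b‖ ≤ μ j)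
    (hμ72 : ∀ j < K - n, 72 * μ j ≤ 1) (hμN : ∀ j < K - n, 3 * μ j + 1 / 24 < deltaSU (Fin 2))
    {θ : ℝ} (hθ0 : 0 ≤ θ) (hμθ : ∀ j < K - n, 7800 * (F.L : ℝ) ^ 3 * (F.L : ℝ) ^ (K - n) * μ j ≤ θ * (F.L : ℝ) ^ j)
    (hθL : 1000 * θ * (F.L : ℝ) ≤ 1) :
    ∀ i ≤ K - n, ∑ c : PBond (F.P K) i, ‖(pertVar (Averaging.iter (fun i => blockAvg (P := (F.P K)) (j := i) (expMeanLogSU (n := Fin 2))) i U₀) (Averaging.iter (fun i => blockAvg (P := (F.P K)) (j := i) (expMeanLogSU (n := Fin 2))) i W)) c - Q i (pertVar U₀ W) c‖ ^ 2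
      ≤ (24 * (200 * (F.L : ℝ) ^ 4 * ((∑ x : Site (F.P K) 0, ∑ μ : Fin (F.P K).d, ∑ ν : Fin (F.P K).d,
            (if μ < ν then ∑ j : Fin 2, ∑ k : Fin 2,
              ‖(curl (torusT (F.P K) 0) (fun κ z => unitsField (toUField U₀) ⟨z, κ⟩) (fun κ z => pertVar U₀ W ⟨z, κ⟩) μ ν x) j k‖ ^ 2 else 0)) + (∑ x : Site (F.P K) 0, ∑ j : Fin 2, ∑ k : Fin 2,
            ‖(divB (torusT (F.P K) 0) (fun κ z => unitsField (toUField U₀) ⟨z, κ⟩) (fun κ z => pertVar U₀ W ⟨z, κ⟩) x) j k‖ ^ 2)) + 4 * 10 ^ 9 * (F.L : ℝ) ^ 9 * ε * (((F.L : ℝ) ^ (K - n)) ^ 2)⁻¹ * (∑ b : PBond (F.P K) 0, ‖pertVar U₀ W b‖ ^ 2))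
            + 1000000 * (F.L : ℝ) ^ 4 * θ ^ 2 * (((F.L : ℝ) ^ (K - n)) ^ 2)⁻¹ * (∑ b : PBond (F.P K) 0, ‖pertVar U₀ W b‖ ^ 2)) * (F.L : ℝ) ^ i := by
  -- T³ letters and the tower sizes (as in ✓ `…CurvedLandauCoreFibreT3`)
  have hL3 := three_le_L F
  have hLpos : (0 : ℝ) < (F.L : ℝ) := by linarith only [hL3]
  have hLF : (F.P K).L = F.L := rfl
  have hk : K - n ≤ (F.P K).m + (F.P K).K := by show K - n ≤ F.m + K; omega
  obtain ⟨-, hε3, hε2, hε24, -⟩ := smallness_T3 F K hε hεL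
  have hε' : 0 < 2 * ε := by linarith only [hε]
  have hU' : PlaqSmall (2 * ε * ((((F.P K).L : ℝ) ^ (K - n))⁻¹) ^ 2) U₀ := by
    refine plaqSmall_of_le_of_lt hU ?_
    rw [hLF, inv_pow]
    exact mul_lt_mul_of_pos_right (by linarith only [hε]) (inv_pos.mpr (by positivity))
  have hα := loop_size_geom (N := 2) (K - n) hε' hε3 hε2 hU'
  obtain ⟨hale, h24, hN⟩ := size_numerals (N := 2) (K - n) hε' hε2 hε24
  have ha0 : ∀ j : ℕ, (0 : ℝ) ≤ (((((F.P K).d + 2) * (F.P K).L : ℕ) : ℝ) ^ 2 / 2 * (2 * ε) * ((((F.P K).L : ℝ)) ^ (2 * j) / (((F.P K).L : ℝ)) ^ (2 * (K - n)))) := fun j => by positivity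
  have ha'0 : (0 : ℝ) ≤ 2 * (2 * ε) := by positivity
  have hV : ∀ j < K - n, ∀ q : Plaq (F.P K) j,
      dist1 (GaugeField.plaqHol (Averaging.iter (fun i => blockAvg (P := (F.P K)) (j := i) (expMeanLogSU (n := Fin 2))) j U₀) q) ≤ 2 * (2 * ε) :=
    fun j hj q => ((tower_plaq_lt (K - n) hε' hε3 hε2 hU' hj.le q).2).le
  obtain ⟨hρ0, hρ1, -, hρ2L⟩ := rho_facts F K
  obtain ⟨hD0, hD12, -⟩ := two_sqrt_d_facts F K
  -- the level rows (✓ `Prop7FibreLevelMass.sqrt_sum_normSq_levelRatio_le` at every level `l ≤ K − n`)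
  have hrec : ∀ l ≤ K - n, Real.sqrt (∑ b : PBond (F.P K) l, ‖(pertVar (Averaging.iter (fun i => blockAvg (P := (F.P K)) (j := i) (expMeanLogSU (n := Fin 2))) l U₀) (Averaging.iter (fun i => blockAvg (P := (F.P K)) (j := i) (expMeanLogSU (n := Fin 2))) l W)) b‖ ^ 2)
      ≤ Real.sqrt (((((F.P K).L : ℝ)) ^ (F.P K).d)⁻¹ * (((F.P K).L : ℝ)) ^ 2) ^ l * Real.exp ((159 * ((((F.P K).d + 2) * (F.P K).L : ℕ) : ℝ) * Real.sqrt (2 * (F.P K).d * (((F.P K).L : ℝ)) ^ (F.P K).d * (2 * (F.P K).d))) / Real.sqrt (((((F.P K).L : ℝ)) ^ (F.P K).d)⁻¹ * (((F.P K).L : ℝ)) ^ 2) * ∑ i ∈ Finset.range l, (((((F.P K).d + 2) * (F.P K).L : ℕ) : ℝ) ^ 2 / 2 * (2 * ε) * ((((F.P K).L : ℝ)) ^ (2 * i) / (((F.P K).L : ℝ)) ^ (2 * (K - n))))) * Real.sqrt (∑ b : PBond (F.P K) 0, ‖pertVar U₀ W b‖ ^ 2)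
        + 2 * Real.sqrt (F.P K).d * Real.sqrt (∑ y : Site (F.P K) l, ‖Λ l y‖ ^ 2)
        + (Real.exp ((159 * ((((F.P K).d + 2) * (F.P K).L : ℕ) : ℝ) * Real.sqrt (2 * (F.P K).d * (((F.P K).L : ℝ)) ^ (F.P K).d * (2 * (F.P K).d))) / Real.sqrt (((((F.P K).L : ℝ)) ^ (F.P K).d)⁻¹ * (((F.P K).L : ℝ)) ^ 2) * ∑ i ∈ Finset.range l, (((((F.P K).d + 2) * (F.P K).L : ℕ) : ℝ) ^ 2 / 2 * (2 * ε) * ((((F.P K).L : ℝ)) ^ (2 * i) / (((F.P K).L : ℝ)) ^ (2 * (K - n))))) * (∑ i ∈ Finset.range l, Real.sqrt (((((F.P K).L : ℝ)) ^ (F.P K).d)⁻¹ * (((F.P K).L : ℝ)) ^ 2) ^ (l - 1 - i) * (260 * (μ i * (((((F.P K).d + 2) * (F.P K).L : ℕ) : ℝ) * Real.sqrt (2 * (F.P K).d * (((F.P K).L : ℝ)) ^ (F.P K).d * (2 * (F.P K).d)) * Real.sqrt (∑ b : PBond (F.P K) i, ‖(pertVar (Averaging.iter (fun i => blockAvg (P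 := (F.P K)) (j := i) (expMeanLogSU (n := Fin 2))) i U₀) (Averaging.iter (fun i => blockAvg (P := (F.P K)) (j := i) (expMeanLogSU (n := Fin 2))) i W)) b‖ ^ 2)))))
        + 2 * Real.sqrt (F.P K).d * ∑ j ∈ Finset.range l, Real.sqrt (4 * (F.P K).d * ((((F.P K).d : ℝ) + 2) ^ 2 * (2 : ℕ) * (((F.P K).L : ℝ)) ^ 4) + (4 * (((F.P K).d : ℝ) + 2) ^ 2 * ((F.P K).d : ℝ) ^ 3 * (3 * (2 : ℕ) + 2 * (F.P K).d) * (((F.P K).L : ℝ)) ^ 6) * (2 * (2 * ε)) ^ 2) * (Real.exp ((159 * ((((F.P K).d + 2) * (F.P K).L : ℕ) : ℝ) * Real.sqrt (2 * (F.P K).d * (((F.P K).L : ℝ)) ^ (F.P K).d * (2 * (F.P K).d))) / Real.sqrt (((((F.P K).L : ℝ)) ^ (F.P K).d)⁻¹ * (((F.P K).L : ℝ)) ^ 2) * ∑ i ∈ Finset.range j, (((((F.P K).d + 2) * (F.P K).L : ℕ) : ℝ) ^ 2 / 2 * (2 * ε) * ((((F.P K).L : ℝ)) ^ (2 * i) /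 (((F.P K).L : ℝ)) ^ (2 * (K - n))))) * (∑ i ∈ Finset.range j, Real.sqrt (((((F.P K).L : ℝ)) ^ (F.P K).d)⁻¹ * (((F.P K).L : ℝ)) ^ 2) ^ (j - 1 - i) * (260 * (μ i * (((((F.P K).d + 2) * (F.P K).L : ℕ) : ℝ) * Real.sqrt (2 * (F.P K).d * (((F.P K).L : ℝ)) ^ (F.P K).d * (2 * (F.P K).d)) * Real.sqrt (∑ b : PBond (F.P K) i, ‖(pertVar (Averaging.iter (fun i => blockAvg (P := (F.P K)) (j := i) (expMeanLogSU (n := Fin 2))) i U₀) (Averaging.iter (fun i => blockAvg (P := (F.P K)) (j := i) (expMeanLogSU (n := Fin 2))) i W)) b‖ ^ 2))))))) := by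
    intro l hl
    exact sqrt_sum_normSq_levelRatio_le U₀ W (hl.trans hk) Q hQ0 hQs G S Λ hG0 hS0 hΛ0 hΛs hGs hSs (fun j => (((((F.P K).d + 2) * (F.P K).L : ℕ) : ℝ) ^ 2 / 2 * (2 * ε) * ((((F.P K).L : ℝ)) ^ (2 * j) / (((F.P K).L : ℝ)) ^ (2 * (K - n))))) ha0 ha'0
      (fun j hj => hα j (lt_of_lt_of_le hj hl)) (fun j hj => (hale j (lt_of_lt_of_le hj hl)).trans h24) (fun j hj => (hale j (lt_of_lt_of_le hj hl)).trans_lt hN)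
      (fun j hj => hV j (lt_of_lt_of_le hj hl)) μ (fun j hj => hμ0 j (lt_of_lt_of_le hj hl)) (fun j hj => hμ j (lt_of_lt_of_le hj hl))
      (fun j hj => hμ72 j (lt_of_lt_of_le hj hl)) (fun j hj => by linarith only [hμN j (lt_of_lt_of_le hj hl), (hale j (lt_of_lt_of_le hj hl)).trans h24])
  -- the scalar inputs of the induction
  have he : ∀ j ≤ K - n, 0 ≤ Real.exp ((159 * ((((F.P K).d + 2) * (F.P K).L : ℕ) : ℝ) * Real.sqrt (2 * (F.P K).d * (((F.P K).L : ℝ)) ^ (F.P K).d * (2 * (F.P K).d))) / Real.sqrt (((((F.P K).L : ℝ)) ^ (F.P K).d)⁻¹ * (((F.P K).L : ℝ)) ^ 2) * ∑ i ∈ Finset.range j, (((((F.P K).d + 2) * (F.P K).L : ℕ) : ℝ) ^ 2 / 2 * (2 * ε) * ((((F.P K).L : ℝ)) ^ (2 * i) / (((F.P K).L : ℝ)) ^ (2 * (K - n))))) ∧ Real.exp ((159 * ((((F.P K).d + 2) * (F.P K).L : ℕ) : ℝ) * Real.sqrt (2 * (F.P K).d * (((F.P K).L : ℝ)) ^ (F.P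 K).d * (2 * (F.P K).d))) / Real.sqrt (((((F.P K).L : ℝ)) ^ (F.P K).d)⁻¹ * (((F.P K).L : ℝ)) ^ 2) * ∑ i ∈ Finset.range j, (((((F.P K).d + 2) * (F.P K).L : ℕ) : ℝ) ^ 2 / 2 * (2 * ε) * ((((F.P K).L : ℝ)) ^ (2 * i) / (((F.P K).L : ℝ)) ^ (2 * (K - n))))) ≤ 3 / 2 :=
    fun j hj => ⟨(Real.exp_pos _).le, level_exp_le F n K hε hεL j hj⟩
  have hBsq0 : 0 ≤ (200 * (F.L : ℝ) ^ 4 * ((∑ x : Site (F.P K) 0, ∑ μ : Fin (F.P K).d, ∑ ν : Fin (F.P K).d,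
            (if μ < ν then ∑ j : Fin 2, ∑ k : Fin 2,
              ‖(curl (torusT (F.P K) 0) (fun κ z => unitsField (toUField U₀) ⟨z, κ⟩) (fun κ z => pertVar U₀ W ⟨z, κ⟩) μ ν x) j k‖ ^ 2 else 0)) + (∑ x : Site (F.P K) 0, ∑ j : Fin 2, ∑ k : Fin 2,
            ‖(divB (torusT (F.P K) 0) (fun κ z => unitsField (toUField U₀) ⟨z, κ⟩) (fun κ z => pertVar U₀ W ⟨z, κ⟩) x) j k‖ ^ 2)) + 4 * 10 ^ 9 * (F.L : ℝ) ^ 9 * ε * (((F.L : ℝ) ^ (K - n)) ^ 2)⁻¹ * (∑ b : PBond (F.P K) 0, ‖pertVar U₀ W b‖ ^ 2)) := by positivity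
  have hΛlev := sum_normSq_covIterLambda_le_level F n K U₀ hε hεL hU (pertVar U₀ W) G S Λ hΛ0 hG0 hS0 hΛs hGs hSs
  have hlam : ∀ l ≤ K - n, 0 ≤ Real.sqrt (∑ y : Site (F.P K) l, ‖Λ l y‖ ^ 2) ∧ Real.sqrt (((((F.P K).L : ℝ)) ^ (F.P K).d)⁻¹ * (((F.P K).L : ℝ)) ^ 2) ^ l * Real.sqrt (∑ y : Site (F.P K) l, ‖Λ l y‖ ^ 2) ≤ Real.sqrt (200 * (F.L : ℝ) ^ 4 * ((∑ x : Site (F.P K) 0, ∑ μ : Fin (F.P K).d, ∑ ν : Fin (F.P K).d,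
            (if μ < ν then ∑ j : Fin 2, ∑ k : Fin 2,
              ‖(curl (torusT (F.P K) 0) (fun κ z => unitsField (toUField U₀) ⟨z, κ⟩) (fun κ z => pertVar U₀ W ⟨z, κ⟩) μ ν x) j k‖ ^ 2 else 0)) + (∑ x : Site (F.P K) 0, ∑ j : Fin 2, ∑ k : Fin 2,
            ‖(divB (torusT (F.P K) 0) (fun κ z => unitsField (toUField U₀) ⟨z, κ⟩) (fun κ z => pertVar U₀ W ⟨z, κ⟩) x) j k‖ ^ 2)) + 4 * 10 ^ 9 * (F.L : ℝ) ^ 9 * ε * (((F.L : ℝ) ^ (K - n)) ^ 2)⁻¹ * (∑ b : PBond (F.P K) 0, ‖pertVar U₀ W b‖ ^ 2)) :=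
    fun l hl => ⟨Real.sqrt_nonneg _, rho_pow_mul_sqrt_le F K (Finset.sum_nonneg fun _ _ => sq_nonneg _) (hΛlev l hl)⟩
  have hC10 : 0 ≤ (((((F.P K).d + 2) * (F.P K).L : ℕ) : ℝ) * Real.sqrt (2 * (F.P K).d * (((F.P K).L : ℝ)) ^ (F.P K).d * (2 * (F.P K).d))) := by positivity
  have hμ' : ∀ l < K - n, 0 ≤ μ l ∧ 260 * (μ l * (((((F.P K).d + 2) * (F.P K).L : ℕ) : ℝ) * Real.sqrt (2 * (F.P K).d * (((F.P K).L : ℝ)) ^ (F.P K).d * (2 * (F.P K).d)))) ≤ θ * Real.sqrt (((((F.P K).L : ℝ)) ^ (F.P K).d)⁻¹ * (((F.P K).L : ℝ)) ^ 2) ^ (2 * ((K - n) - l)) :=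
    fun l hl => ⟨hμ0 l hl, coeff_of_B6 F n K hl.le (hμ0 l hl) (hμθ l hl)⟩
  have hsmall := theta_smallness F K hε hεL hθ0 hθL
  -- ★ per level `i`: the depth-`i` coefficient `θ_i := θ·ρ^{2((K−n)−i)}` and the induction up to `i`
  intro i hi
  have hik : i ≤ (F.P K).m + (F.P K).K := hi.trans hk
  have hθi0 : 0 ≤ θ * Real.sqrt (((((F.P K).L : ℝ)) ^ (F.P K).d)⁻¹ * (((F.P K).L : ℝ)) ^ 2) ^ (2 * ((K - n) - i)) := mul_nonneg hθ0 (pow_nonneg hρ0.le _)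
  have hθile : θ * Real.sqrt (((((F.P K).L : ℝ)) ^ (F.P K).d)⁻¹ * (((F.P K).L : ℝ)) ^ 2) ^ (2 * ((K - n) - i)) ≤ θ := by
    have h1 : Real.sqrt (((((F.P K).L : ℝ)) ^ (F.P K).d)⁻¹ * (((F.P K).L : ℝ)) ^ 2) ^ (2 * ((K - n) - i)) ≤ 1 := pow_le_one₀ hρ0.le hρ1.le
    have h2 := mul_le_mul_of_nonneg_left h1 hθ0
    linarith [h2]
  have hμ'i : ∀ l < i, 0 ≤ μ l ∧ 260 * (μ l * (((((F.P K).d + 2) * (F.P K).L : ℕ) : ℝ) * Real.sqrt (2 * (F.P K).d * (((F.P K).L : ℝ)) ^ (F.P K).d * (2 * (F.P K).d)))) ≤ θ * Real.sqrt (((((F.P K).L : ℝ)) ^ (F.P K).d)⁻¹ * (((F.P K).L : ℝ)) ^ 2) ^ (2 * ((K - n) - i)) * Real.sqrt (((((F.P K).L : ℝ)) ^ (F.P K).d)⁻¹ * (((F.P K).L : ℝ)) ^ 2) ^ (2 * (i - l)) := by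
    intro l hl
    have hlK : l < K - n := lt_of_lt_of_le hl hi
    refine ⟨(hμ' l hlK).1, ?_⟩
    have e : θ * Real.sqrt (((((F.P K).L : ℝ)) ^ (F.P K).d)⁻¹ * (((F.P K).L : ℝ)) ^ 2) ^ (2 * ((K - n) - i)) * Real.sqrt (((((F.P K).L : ℝ)) ^ (F.P K).d)⁻¹ * (((F.P K).L : ℝ)) ^ 2) ^ (2 * (i - l)) = θ * Real.sqrt (((((F.P K).L : ℝ)) ^ (F.P K).d)⁻¹ * (((F.P K).L : ℝ)) ^ 2) ^ (2 * ((K - n) - l)) := by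
      rw [mul_assoc, ← pow_add]; congr 2; omega
    rw [e]; exact (hμ' l hlK).2
  have hsmalli : θ * Real.sqrt (((((F.P K).L : ℝ)) ^ (F.P K).d)⁻¹ * (((F.P K).L : ℝ)) ^ 2) ^ (2 * ((K - n) - i)) * (3 / 2) * (1 + 2 * Real.sqrt (F.P K).d * Real.sqrt (4 * (F.P K).d * ((((F.P K).d : ℝ) + 2) ^ 2 * (2 : ℕ) * (((F.P K).L : ℝ)) ^ 4) + (4 * (((F.P K).d : ℝ) + 2) ^ 2 * ((F.P K).d : ℝ) ^ 3 * (3 * (2 : ℕ) + 2 * (F.P K).d) * (((F.P K).L : ℝ)) ^ 6) * (2 * (2 * ε)) ^ 2) * (Real.sqrt (((((F.P K).L : ℝ)) ^ (F.P K).d)⁻¹ * (((F.P K).L : ℝ)) ^ 2) / (1 - Real.sqrt (((((F.P K).L : ℝ)) ^ (F.P K).d)⁻¹ * (((F.P K).L : ℝ)) ^ 2)))) * (Real.sqrt (((((F.P K).L : ℝ)) ^ (F.P K).d)⁻¹ * (((F.P K).L : ℝ)) ^ 2) ^ 3 / (1 - Real.sqrt (((((F.P K).L : ℝ)) ^ (F.P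 K).d)⁻¹ * (((F.P K).L : ℝ)) ^ 2) ^ 4)) ≤ 1 / 2 := by
    have hK := K0_nonneg F K (ε := ε)
    have hq0 : 0 ≤ (Real.sqrt (((((F.P K).L : ℝ)) ^ (F.P K).d)⁻¹ * (((F.P K).L : ℝ)) ^ 2) ^ 3 / (1 - Real.sqrt (((((F.P K).L : ℝ)) ^ (F.P K).d)⁻¹ * (((F.P K).L : ℝ)) ^ 2) ^ 4)) := div_nonneg (pow_nonneg hρ0.le 3) (sub_nonneg.2 (pow_le_one₀ hρ0.le hρ1.le))
    have h1 := mul_le_mul_of_nonneg_right (mul_le_mul_of_nonneg_right (mul_le_mul_of_nonneg_right hθile (by norm_num : (0 : ℝ) ≤ 3 / 2)) hK) hq0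
    exact h1.trans hsmall
  obtain ⟨-, htop⟩ := levelMass_induction hρ0 hρ1 hθi0 (by norm_num : (0 : ℝ) ≤ 3 / 2) (Real.sqrt_nonneg _ : 0 ≤ Real.sqrt (4 * (F.P K).d * ((((F.P K).d : ℝ) + 2) ^ 2 * (2 : ℕ) * (((F.P K).L : ℝ)) ^ 4) + (4 * (((F.P K).d : ℝ) + 2) ^ 2 * ((F.P K).d : ℝ) ^ 3 * (3 * (2 : ℕ) + 2 * (F.P K).d) * (((F.P K).L : ℝ)) ^ 6) * (2 * (2 * ε)) ^ 2)) hD0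
    (Real.sqrt_nonneg _ : 0 ≤ Real.sqrt (200 * (F.L : ℝ) ^ 4 * ((∑ x : Site (F.P K) 0, ∑ μ : Fin (F.P K).d, ∑ ν : Fin (F.P K).d,
            (if μ < ν then ∑ j : Fin 2, ∑ k : Fin 2,
              ‖(curl (torusT (F.P K) 0) (fun κ z => unitsField (toUField U₀) ⟨z, κ⟩) (fun κ z => pertVar U₀ W ⟨z, κ⟩) μ ν x) j k‖ ^ 2 else 0)) + (∑ x : Site (F.P K) 0, ∑ j : Fin 2, ∑ k : Fin 2,
            ‖(divB (torusT (F.P K) 0) (fun κ z => unitsField (toUField U₀) ⟨z, κ⟩) (fun κ z => pertVar U₀ W ⟨z, κ⟩) x) j k‖ ^ 2)) + 4 * 10 ^ 9 * (F.L : ℝ) ^ 9 * ε * (((F.L : ℝ) ^ (K - n)) ^ 2)⁻¹ * (∑ b : PBond (F.P K) 0, ‖pertVar U₀ W b‖ ^ 2))) hC10 (Real.sqrt_nonneg _ : 0 ≤ Real.sqrt (∑ b : PBond (F.P K) 0, ‖pertVar U₀ W b‖ ^ 2)) i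
    (fun l => Real.sqrt (∑ b : PBond (F.P K) l, ‖(pertVar (Averaging.iter (fun i => blockAvg (P := (F.P K)) (j := i) (expMeanLogSU (n := Fin 2))) l U₀) (Averaging.iter (fun i => blockAvg (P := (F.P K)) (j := i) (expMeanLogSU (n := Fin 2))) l W)) b‖ ^ 2)) (fun j => Real.exp ((159 * ((((F.P K).d + 2) * (F.P K).L : ℕ) : ℝ) * Real.sqrt (2 * (F.P K).d * (((F.P K).L : ℝ)) ^ (F.P K).d * (2 * (F.P K).d))) / Real.sqrt (((((F.P K).L : ℝ)) ^ (F.P K).d)⁻¹ * (((F.P K).L : ℝ)) ^ 2) * ∑ i ∈ Finset.range j, (((((F.P K).d + 2) * (F.P K).L : ℕ) : ℝ) ^ 2 / 2 * (2 * ε) * ((((F.P K).L : ℝ)) ^ (2 * i) / (((F.P K).L : ℝ)) ^ (2 * (K - n)))))) (fun l => Real.sqrt (∑ y : Site (F.P K) l, ‖Λ l y‖ ^ 2)) μ (fun j => (∑ i ∈ Finset.range j, Real.sqrt (((((F.P K).L : ℝ)) ^ (F.P K).d)⁻¹ * (((F.P K).L : ℝ)) ^ 2) ^ (j - 1 - i)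 * (260 * (μ i * (((((F.P K).d + 2) * (F.P K).L : ℕ) : ℝ) * Real.sqrt (2 * (F.P K).d * (((F.P K).L : ℝ)) ^ (F.P K).d * (2 * (F.P K).d)) * Real.sqrt (∑ b : PBond (F.P K) i, ‖(pertVar (Averaging.iter (fun i => blockAvg (P := (F.P K)) (j := i) (expMeanLogSU (n := Fin 2))) i U₀) (Averaging.iter (fun i => blockAvg (P := (F.P K)) (j := i) (expMeanLogSU (n := Fin 2))) i W)) b‖ ^ 2))))))
    (fun l => Real.sqrt_nonneg _) (fun j hj => he j (hj.trans hi)) (fun l hl => hlam l (hl.trans hi)) hμ'i (fun j => rfl) (fun l hl => hrec l (hl.trans hi)) hsmalli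
  -- ★ the defect at level `i` (✓ `sqrt_sum_normSq_levelRatio_sub_trueLinIter_le_mass`): `√Z_i ≤ E_iS_i + 2√dΣC_CM E_jS_j`
  have hJ := sqrt_sum_normSq_levelRatio_sub_trueLinIter_le_mass U₀ W hik Q hQ0 hQs (fun j => (((((F.P K).d + 2) * (F.P K).L : ℕ) : ℝ) ^ 2 / 2 * (2 * ε) * ((((F.P K).L : ℝ)) ^ (2 * j) / (((F.P K).L : ℝ)) ^ (2 * (K - n))))) ha0 ha'0
    (fun j hj => hα j (lt_of_lt_of_le hj hi)) (fun j hj => (hale j (lt_of_lt_of_le hj hi)).trans h24) (fun j hj => (hale j (lt_of_lt_of_le hj hi)).trans_lt hN)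
    (fun j hj => hV j (lt_of_lt_of_le hj hi)) μ (fun j hj => hμ0 j (lt_of_lt_of_le hj hi)) (fun j hj => hμ j (lt_of_lt_of_le hj hi))
    (fun j hj => hμ72 j (lt_of_lt_of_le hj hi)) (fun j hj => by linarith only [hμN j (lt_of_lt_of_le hj hi), (hale j (lt_of_lt_of_le hj hi)).trans h24])
  have hZ0 : 0 ≤ ∑ c : PBond (F.P K) i, ‖(pertVar (Averaging.iter (fun i => blockAvg (P := (F.P K)) (j := i) (expMeanLogSU (n := Fin 2))) i U₀) (Averaging.iter (fun i => blockAvg (P := (F.P K)) (j := i) (expMeanLogSU (n := Fin 2))) i W)) c - Q i (pertVar U₀ W) c‖ ^ 2 := Finset.sum_nonneg fun _ _ => sq_nonneg _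
  have hR0 := le_trans (Real.sqrt_nonneg _) hJ
  have hZR := pow_le_pow_left₀ (Real.sqrt_nonneg _) hJ 2
  rw [Real.sq_sqrt hZ0] at hZR
  have hRW := sq_le_of_rho_pow_mul_le F K i hR0 htop
  have hm0 : 0 ≤ (∑ b : PBond (F.P K) 0, ‖pertVar U₀ W b‖ ^ 2) := Finset.sum_nonneg fun _ _ => sq_nonneg _
  have hend := endgame (θ * Real.sqrt (((((F.P K).L : ℝ)) ^ (F.P K).d)⁻¹ * (((F.P K).L : ℝ)) ^ 2) ^ (2 * ((K - n) - i))) (Real.sqrt (∑ b : PBond (F.P K) 0, ‖pertVar U₀ W b‖ ^ 2)) i hL3 hρ2L hD12 (K0_nonneg F K (ε := ε)) (K0_le F K hε hεL) hBsq0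
  rw [Real.sq_sqrt hm0] at hend
  -- `θ_i²·(Lⁱ)⁻¹ = θ²·ℓ⁻²·Lⁱ` (`ρ²L = 1`)
  have hρ2 : Real.sqrt (((((F.P K).L : ℝ)) ^ (F.P K).d)⁻¹ * (((F.P K).L : ℝ)) ^ 2) ^ 2 = ((F.L : ℝ))⁻¹ := eq_inv_of_mul_eq_one_left hρ2L
  have hLi : (F.L : ℝ) ^ (K - n) = (F.L : ℝ) ^ ((K - n) - i) * (F.L : ℝ) ^ i := by rw [← pow_add]; congr 1; omega
  have hconv : 1000000 * (F.L : ℝ) ^ 4 * (θ * Real.sqrt (((((F.P K).L : ℝ)) ^ (F.P K).d)⁻¹ * (((F.P K).L : ℝ)) ^ 2) ^ (2 * ((K - n) - i))) ^ 2 * ((F.L : ℝ) ^ i)⁻¹ * (∑ b : PBond (F.P K) 0, ‖pertVar U₀ W b‖ ^ 2)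
      = 1000000 * (F.L : ℝ) ^ 4 * θ ^ 2 * (((F.L : ℝ) ^ (K - n)) ^ 2)⁻¹ * (∑ b : PBond (F.P K) 0, ‖pertVar U₀ W b‖ ^ 2) * (F.L : ℝ) ^ i := by
    have e1 : (θ * Real.sqrt (((((F.P K).L : ℝ)) ^ (F.P K).d)⁻¹ * (((F.P K).L : ℝ)) ^ 2) ^ (2 * ((K - n) - i))) ^ 2 = θ ^ 2 * (((F.L : ℝ) ^ ((K - n) - i)) ^ 2)⁻¹ := by
      rw [mul_pow, ← pow_mul, show 2 * ((K - n) - i) * 2 = 2 * (2 * ((K - n) - i)) by ring, pow_mul, hρ2, inv_pow, ← pow_mul,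
        show (K - n - i) * 2 = 2 * ((K - n) - i) by ring]
    have hLne : (F.L : ℝ) ≠ 0 := hLpos.ne'
    rw [e1, hLi]
    field_simp
  linarith only [hZR, hRW, hend, hconv.le, hconv.ge]

/-! ## §3 ★★ The title: the level ratios minus the sourceless reduced family -/

/-- ★★ **THE DEVIATION OF THE LEVEL RATIOS FROM THE SOURCELESS REDUCED FAMILY, IN (n3)'s NUMERALS** (d = 3, `SU(2)`; binders as in §2; N6b's socket `Σ_b‖Y_i b − G1 i b‖²` at
`U₀ := W`, `W := e^{iX}W`, `G := G1`): for every `i ≤ K − n`,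
`Σ_b‖Y_i b − G i b‖² ≤ (72·(200L⁴(CURL + DIV) + 4·10⁹L⁹εℓ⁻²Σ‖Y‖²) + 2·10⁶·L⁴·θ²·ℓ⁻²·Σ‖Y‖²)·Lⁱ` (§1: `2·§2 + 8·3·(R-B)`, `2·24 + 24 = 72`).
[cite: Balaban1985Averaging, Prop. 3 (122)-(126) p.36; Balaban1984PropagatorsI, (1.18)-(1.20) pp.19-20; Balaban1985BackgroundPropagators, Thm 3.11 p.416; Balaban1985Variational, (14)-(15) p.280, Prop. 7 p.299] -/
theorem sum_normSq_levelRatio_sub_reduced_le_T3 (F : T3Family) (n K : ℕ)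
    (U₀ W : GaugeField (F.P K) 0 (Matrix.specialUnitaryGroup (Fin 2) ℂ)) {ε : ℝ} (hε : 0 < ε) (hεL : 1000000 * (F.L : ℝ) ^ 5 * ε ≤ 1)
    (hU : ∀ p : Plaq (F.P K) 0, dist1 (GaugeField.plaqHol U₀ p) ≤ ε * (((F.L : ℝ) ^ (K - n)) ^ 2)⁻¹)
    (Q : (k : ℕ) → (PBond (F.P K) 0 → Matrix (Fin 2) (Fin 2) ℂ) → PBond (F.P K) k → Matrix (Fin 2) (Fin 2) ℂ) (hQ0 : ∀ Y, Q 0 Y = Y)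
    (hQs : ∀ (k : ℕ) (Y : PBond (F.P K) 0 → Matrix (Fin 2) (Fin 2) ℂ) (c : PBond (F.P K) (k + 1)), Q (k + 1) Y c
      = (fderiv ℂ (eml : (Idx (F.P K) → Matrix (Fin 2) (Fin 2) ℂ) → Matrix (Fin 2) (Fin 2) ℂ)
            (fun i => ((loopHol (Averaging.iter (fun i => blockAvg (P := (F.P K)) (j := i) (expMeanLogSU (n := Fin 2))) k U₀) c i : Matrix.specialUnitaryGroup (Fin 2) ℂ) : Matrix (Fin 2) (Fin 2) ℂ))
            (fun i => covWalkSum (Averaging.iter (fun i => blockAvg (P := (F.P K)) (j := i) (expMeanLogSU (n := Fin 2))) k U₀) (Q k Y) (walk (emb c.src) (loopWord (F.P K).L c.dir (off i.1) i.2.1 i.2.2))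
              * ((loopHol (Averaging.iter (fun i => blockAvg (P := (F.P K)) (j := i) (expMeanLogSU (n := Fin 2))) k U₀) c i : Matrix.specialUnitaryGroup (Fin 2) ℂ) : Matrix (Fin 2) (Fin 2) ℂ))
            * star ((corr (expMeanLogSU (n := Fin 2)) (Averaging.iter (fun i => blockAvg (P := (F.P K)) (j := i) (expMeanLogSU (n := Fin 2))) k U₀) c : Matrix.specialUnitaryGroup (Fin 2) ℂ) : Matrix (Fin 2) (Fin 2) ℂ)
          + ((corr (expMeanLogSU (n := Fin 2)) (Averaging.iter (fun i => blockAvg (P := (F.P K)) (j := i) (expMeanLogSU (n := Fin 2))) k U₀) c : Matrix.specialUnitaryGroup (Fin 2) ℂ) : Matrix (Fin 2) (Fin 2) ℂ)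
            * covWalkSum (Averaging.iter (fun i => blockAvg (P := (F.P K)) (j := i) (expMeanLogSU (n := Fin 2))) k U₀) (Q k Y) (walk (emb c.src) (List.replicate (F.P K).L (c.dir, true)))
            * star ((corr (expMeanLogSU (n := Fin 2)) (Averaging.iter (fun i => blockAvg (P := (F.P K)) (j := i) (expMeanLogSU (n := Fin 2))) k U₀) c : Matrix.specialUnitaryGroup (Fin 2) ℂ) : Matrix (Fin 2) (Fin 2) ℂ)))
    (G S : (k : ℕ) → PBond (F.P K) k → Matrix (Fin 2) (Fin 2) ℂ) (Λ : (k : ℕ) → Site (F.P K) k → Matrix (Fin 2) (Fin 2) ℂ)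
    (hG0 : ∀ b, G 0 b = pertVar U₀ W b) (hS0 : ∀ b, S 0 b = pertVar U₀ W b) (hΛ0 : ∀ x, Λ 0 x = 0)
    (hΛs : ∀ (k : ℕ) (z : Site (F.P K) (k + 1)), Λ (k + 1) z
      = (((Fintype.card (Idx (F.P K)) : ℂ))⁻¹ • ∑ i : Idx (F.P K),
              covWalkSum (Averaging.iter (fun i => blockAvg (P := (F.P K)) (j := i) (expMeanLogSU (n := Fin 2))) k U₀) (G k) (walk (emb z) (stairWord i.2.1 (off i.1))))
        + Λ k (emb z))
    (hGs : ∀ (k : ℕ) (c : PBond (F.P K) (k + 1)), G (k + 1) c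
      = (fderiv ℂ (eml : (Idx (F.P K) → Matrix (Fin 2) (Fin 2) ℂ) → Matrix (Fin 2) (Fin 2) ℂ)
            (fun i => ((loopHol (Averaging.iter (fun i => blockAvg (P := (F.P K)) (j := i) (expMeanLogSU (n := Fin 2))) k U₀) c i : Matrix.specialUnitaryGroup (Fin 2) ℂ) : Matrix (Fin 2) (Fin 2) ℂ))
            (fun i => covWalkSum (Averaging.iter (fun i => blockAvg (P := (F.P K)) (j := i) (expMeanLogSU (n := Fin 2))) k U₀) (G k) (walk (emb c.src) (loopWord (F.P K).L c.dir (off i.1) i.2.1 i.2.2))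
              * ((loopHol (Averaging.iter (fun i => blockAvg (P := (F.P K)) (j := i) (expMeanLogSU (n := Fin 2))) k U₀) c i : Matrix.specialUnitaryGroup (Fin 2) ℂ) : Matrix (Fin 2) (Fin 2) ℂ))
            * star ((corr (expMeanLogSU (n := Fin 2)) (Averaging.iter (fun i => blockAvg (P := (F.P K)) (j := i) (expMeanLogSU (n := Fin 2))) k U₀) c : Matrix.specialUnitaryGroup (Fin 2) ℂ) : Matrix (Fin 2) (Fin 2) ℂ)
          + ((corr (expMeanLogSU (n := Fin 2)) (Averaging.iter (fun i => blockAvg (P := (F.P K)) (j := i) (expMeanLogSU (n := Fin 2))) k U₀) c : Matrix.specialUnitaryGroup (Fin 2) ℂ) : Matrix (Fin 2) (Fin 2) ℂ)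
            * covWalkSum (Averaging.iter (fun i => blockAvg (P := (F.P K)) (j := i) (expMeanLogSU (n := Fin 2))) k U₀) (G k) (walk (emb c.src) (List.replicate (F.P K).L (c.dir, true)))
            * star ((corr (expMeanLogSU (n := Fin 2)) (Averaging.iter (fun i => blockAvg (P := (F.P K)) (j := i) (expMeanLogSU (n := Fin 2))) k U₀) c : Matrix.specialUnitaryGroup (Fin 2) ℂ) : Matrix (Fin 2) (Fin 2) ℂ))
        - ((((Fintype.card (Idx (F.P K)) : ℂ))⁻¹ • ∑ i : Idx (F.P K),
              covWalkSum (Averaging.iter (fun i => blockAvg (P := (F.P K)) (j := i) (expMeanLogSU (n := Fin 2))) k U₀) (G k) (walk (emb c.src) (stairWord i.2.1 (off i.1))))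
            - ((Averaging.iter (fun i => blockAvg (P := (F.P K)) (j := i) (expMeanLogSU (n := Fin 2))) (k + 1) U₀ c : Matrix.specialUnitaryGroup (Fin 2) ℂ) : Matrix (Fin 2) (Fin 2) ℂ)
              * (((Fintype.card (Idx (F.P K)) : ℂ))⁻¹ • ∑ i : Idx (F.P K),
              covWalkSum (Averaging.iter (fun i => blockAvg (P := (F.P K)) (j := i) (expMeanLogSU (n := Fin 2))) k U₀) (G k) (walk (emb c.tgt) (stairWord i.2.1 (off i.1))))
              * star ((Averaging.iter (fun i => blockAvg (P := (F.P K)) (j := i) (expMeanLogSU (n := Fin 2))) (k + 1) U₀ c : Matrix.specialUnitaryGroup (Fin 2) ℂ) : Matrix (Fin 2) (Fin 2) ℂ)))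
    (hSs : ∀ (k : ℕ) (c : PBond (F.P K) (k + 1)), S (k + 1) c
      = ((Fintype.card (Idx (F.P K)) : ℂ))⁻¹ • ∑ i : Idx (F.P K),
          ((holAt (Averaging.iter (fun i => blockAvg (P := (F.P K)) (j := i) (expMeanLogSU (n := Fin 2))) k U₀) (walk (emb c.src) (stairWord i.2.1 (off i.1))) : Matrix.specialUnitaryGroup (Fin 2) ℂ) : Matrix (Fin 2) (Fin 2) ℂ) *
            covWalkSum (Averaging.iter (fun i => blockAvg (P := (F.P K)) (j := i) (expMeanLogSU (n := Fin 2))) k U₀) (S k)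
              (walk (walkEnd (emb c.src) (stairWord i.2.1 (off i.1))) (List.replicate (F.P K).L (c.dir, true))) *
          star ((holAt (Averaging.iter (fun i => blockAvg (P := (F.P K)) (j := i) (expMeanLogSU (n := Fin 2))) k U₀) (walk (emb c.src) (stairWord i.2.1 (off i.1))) : Matrix.specialUnitaryGroup (Fin 2) ℂ) : Matrix (Fin 2) (Fin 2) ℂ))
    (μ : ℕ → ℝ) (hμ0 : ∀ j < K - n, 0 ≤ μ j)
    (hμ : ∀ j < K - n, ∀ c : PBond (F.P K) (j + 1), ((((F.P K).d + 2) * (F.P K).L : ℕ) : ℝ) * ∑ b ∈ (univ.filter (fun b : PBond (F.P K) j => blockOf b.src = c.src ∨ blockOf b.src = c.tgt)), ‖(pertVar (Averaging.iter (fun i => blockAvg (P := (F.P K)) (j := i) (expMeanLogSU (n := Fin 2))) j U₀) (Averaging.iter (fun i => blockAvg (P := (F.P K)) (j := i) (expMeanLogSU (n := Fin 2))) j W)) b‖ ≤ μ j)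
    (hμ72 : ∀ j < K - n, 72 * μ j ≤ 1) (hμN : ∀ j < K - n, 3 * μ j + 1 / 24 < deltaSU (Fin 2))
    {θ : ℝ} (hθ0 : 0 ≤ θ) (hμθ : ∀ j < K - n, 7800 * (F.L : ℝ) ^ 3 * (F.L : ℝ) ^ (K - n) * μ j ≤ θ * (F.L : ℝ) ^ j)
    (hθL : 1000 * θ * (F.L : ℝ) ≤ 1) :
    ∀ i ≤ K - n, ∑ c : PBond (F.P K) i, ‖(pertVar (Averaging.iter (fun i => blockAvg (P := (F.P K)) (j := i) (expMeanLogSU (n := Fin 2))) i U₀) (Averaging.iter (fun i => blockAvg (P := (F.P K)) (j := i) (expMeanLogSU (n := Fin 2))) i W)) c - G i c‖ ^ 2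
      ≤ (72 * (200 * (F.L : ℝ) ^ 4 * ((∑ x : Site (F.P K) 0, ∑ μ : Fin (F.P K).d, ∑ ν : Fin (F.P K).d,
            (if μ < ν then ∑ j : Fin 2, ∑ k : Fin 2,
              ‖(curl (torusT (F.P K) 0) (fun κ z => unitsField (toUField U₀) ⟨z, κ⟩) (fun κ z => pertVar U₀ W ⟨z, κ⟩) μ ν x) j k‖ ^ 2 else 0)) + (∑ x : Site (F.P K) 0, ∑ j : Fin 2, ∑ k : Fin 2,
            ‖(divB (torusT (F.P K) 0) (fun κ z => unitsField (toUField U₀) ⟨z, κ⟩) (fun κ z => pertVar U₀ W ⟨z, κ⟩) x) j k‖ ^ 2)) + 4 * 10 ^ 9 * (F.L : ℝ) ^ 9 * ε * (((F.L : ℝ) ^ (K - n)) ^ 2)⁻¹ * (∑ b : PBond (F.P K) 0, ‖pertVar U₀ W b‖ ^ 2))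
            + 2000000 * (F.L : ℝ) ^ 4 * θ ^ 2 * (((F.L : ℝ) ^ (K - n)) ^ 2)⁻¹ * (∑ b : PBond (F.P K) 0, ‖pertVar U₀ W b‖ ^ 2)) * (F.L : ℝ) ^ i := by
  intro i hi
  have hL3 := three_le_L F
  have hLF : (F.P K).L = F.L := rfl
  have hd : ((F.P K).d : ℝ) = 3 := by rw [show (F.P K).d = 3 from rfl]; norm_num
  have hk : K - n ≤ (F.P K).m + (F.P K).K := by show K - n ≤ F.m + K; omega
  obtain ⟨-, hε3, hε2, hε24, -⟩ := smallness_T3 F K hε hεL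
  have hε' : 0 < 2 * ε := by linarith only [hε]
  have hU' : PlaqSmall (2 * ε * ((((F.P K).L : ℝ) ^ (K - n))⁻¹) ^ 2) U₀ := by
    refine plaqSmall_of_le_of_lt hU ?_
    rw [hLF, inv_pow]
    exact mul_lt_mul_of_pos_right (by linarith only [hε]) (inv_pos.mpr (by positivity))
  have hα := loop_size_geom (N := 2) (K - n) hε' hε3 hε2 hU'
  obtain ⟨hale, -, hN⟩ := size_numerals (N := 2) (K - n) hε' hε2 hε24
  -- §1 at level `i`, §2, and (R-B) at level `i`
  have h1 := sum_normSq_levelRatio_sub_reduced_le U₀ W i Q hQ0 hQs G Λ hG0 hΛ0 hΛs hGs (fun j => (((((F.P K).d + 2) * (F.P K).L : ℕ) : ℝ) ^ 2 / 2 * (2 * ε) * ((((F.P K).L : ℝ)) ^ (2 * j) / (((F.P K).L : ℝ)) ^ (2 * (K - n)))))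
    (fun j hj => hα j (lt_of_lt_of_le hj hi)) (fun j hj => (hale j (lt_of_lt_of_le hj hi)).trans_lt hN)
  have h2 := sum_normSq_levelRatio_sub_trueLinIter_le_T3 F n K U₀ W hε hεL hU Q hQ0 hQs G S Λ hG0 hS0 hΛ0 hΛs hGs hSs μ hμ0 hμ hμ72 hμN hθ0 hμθ hθL i hi
  have h3 := sum_normSq_covIterLambda_le_level F n K U₀ hε hεL hU (pertVar U₀ W) G S Λ hΛ0 hG0 hS0 hΛs hGs hSs i hi
  rw [hd] at h1
  have hLi : 0 ≤ (F.L : ℝ) ^ i := by positivity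
  nlinarith [h1, h2, h3, hLi]

end Summit.QuantumFields.YangMills.Theorems.Prop7LevelRatioSubReducedT3

end
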